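import Summits.Ventures.CertifiedManyBodySolver.Observables.NeelClassKineticFloor
import HarnessLib

/-!
# Ventures/CertifiedManyBodySolver — Observables/NeelClassFloorFourthMoment.lean
# The SDW-reference kinetic floor with the FOURTH band moment: `Σ_k ε_k⁴ = 36t⁴L²` and quadratic
# majorants of `√(x + Δ²)` (part 4; parts 1–3: `NeelClassFloorOneBody`, `NeelClassFloorTraces`, `NeelClassKineticFloor`)

HONEST FRAMING: first certified bounds; not a superconductivity verdict; every number certified or labelled float.
A competing-order EXCLUSION removes a named class of candidate ground states; it never says which order is present;
no phase sentence follows.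

Cell `hubbard-tc` (MO-S3, D-0096), seat `hubbard-tc-mod-3` (G3), `prover-hubbard-tc-mod-3-g7-0`. The floor of
`NeelClassKineticFloor.lean` bounds `tr E = Σ_k √(ε_k² + Δ²)` by Cauchy–Schwarz, `L²√(4t² + Δ²)` (second band moment
`Σ_k ε_k² = 4t²L²` only), which loses `≈ 0.05·t` per site at the binding staggered field and `≈ 0.4·t` at small fields. Here:

* §1 `sum_siteBand_pow_four`: on `(ℤ/Lℤ)²`, `L ≥ 5`, `Σ_k ε_k⁴ = 36t⁴L²` — the number of closed four-step walks on `ℤ²`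
  (`36`), by the characters of the torus (`2cos pᵢ = χ_k(eᵢ) + χ_k(−eᵢ)`, `(Σ_s χ_k(s))⁴ = Σ_{walks} χ_k(endpoint)`,
  orthogonality `Σ_k χ_k(w) = L²·[w = 0]`, and for `L ≥ 5` a four-step walk closes on the torus iff it closes on `ℤ²`);
* `siteBand_sq_le`: `ε_k² ≤ 16t²`. The quadratic-majorant floors that use these moments are in `NeelClassFloorQuad.lean`.
Everything is PROVED; no definition, no named fact, no `sorry`.

References: E. H. Lieb, M. Loss, Duke Math. J. 71 (1993) 337, §8 [LiebLoss1993]; S. Friedli, Y. Velenik, Statistical Mechanics of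
Lattice Systems (2017), §10.4 (characters of the torus) [FriedliVelenik2017]; J. S. Langer, D. C. Mattis, Phys. Lett. 36A (1971) 139
[LangerMattis1971]; V. Bach, E. H. Lieb, J. P. Solovej, J. Stat. Phys. 76 (1994) 3, §2 eq. (2c.36) [BachLiebSolovej1994].
-/

noncomputable section

namespace Summit.Ventures.CertifiedManyBodySolver.Observables

namespace NeelClassFloor

open Literature.MathematicalPhysics.QuantumLattice

open Matrix Finset Literature.Probability.LatticeModels
  Literature.MathematicalPhysics.QuantumLattice.RayleighBound
  Literature.MathematicalPhysics.QuantumLattice.HubbardBandBottom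
  Literature.MathematicalPhysics.QuantumLattice.LangerMattis
  Literature.MathematicalPhysics.QuantumLattice.HartreeFock
  Literature.MathematicalPhysics.QuantumLattice.TTPrimeFree
  Literature.MathematicalPhysics.QuantumLattice.FreeKinetic
open scoped ComplexOrder ComplexConjugate

variable {L : ℕ}
/-! ### §1 The fourth band moment `Σ_k ε_k⁴ = 36t⁴L²` (closed four-step walks) -/

section FourthMoment

variable [NeZero L]

/-- `χ_k(eᵢ) + χ_k(−eᵢ) = 2cos pᵢ` (`p = 2πk/L`, `L ≥ 2`). [cite: FriedliVelenik2017, §10.4] -/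
theorem torusChar_single_add_neg (hL : 2 ≤ L) (k : TorusSite 2 L) (i : Fin 2) :
    torusChar k (Pi.single i (1 : ZMod L)) + torusChar k (-(Pi.single i (1 : ZMod L))) =
      ((2 * Real.cos (latticeMomentum L k i) : ℝ) : ℂ) := by
  have hfact : Fact (1 < L) := ⟨by omega⟩
  have hre : (torusChar k (Pi.single i (1 : ZMod L))).re = Real.cos (latticeMomentum L k i) := by
    rw [Literature.Probability.LatticeModels.torusChar_re]
    congr 1
    rw [Finset.sum_eq_single i]
    · rw [Pi.single_eq_same, ZMod.val_one, Nat.cast_one, mul_one]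
    · intro j _ hj
      rw [Pi.single_eq_of_ne hj, ZMod.val_zero, Nat.cast_zero, mul_zero]
    · exact fun h => absurd (Finset.mem_univ i) h
  rw [torusChar_neg_right, Complex.add_conj, hre]

/-- The band as a character sum over the four unit steps: `ε_t(k) = t·Σ_{s ∈ {±e₀, ±e₁}} χ_k(s)`.
[cite: FriedliVelenik2017, §10.4] -/
theorem siteBand_eq_sum_torusChar (hL : 2 ≤ L) (t : ℝ) (k : FermionTorus 2 L) :
    ((siteBand t k : ℝ) : ℂ) = (t : ℂ) * ∑ j : Fin 4,
      torusChar k.toTorusSite ((![Pi.single 0 1, -(Pi.single 0 1), Pi.single 1 1, -(Pi.single 1 1)] :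
        Fin 4 → TorusSite 2 L) j) := by
  rw [Fin.sum_univ_four]
  simp only [Matrix.cons_val_zero, Matrix.cons_val_one, Matrix.head_cons, Matrix.cons_val_two,
    Matrix.tail_cons, Matrix.cons_val_three]
  rw [siteBand, Fin.sum_univ_two, show torusChar k.toTorusSite (Pi.single 0 1) + torusChar k.toTorusSite (-Pi.single 0 1) +
      torusChar k.toTorusSite (Pi.single 1 1) + torusChar k.toTorusSite (-Pi.single 1 1) =
      (torusChar k.toTorusSite (Pi.single 0 1) + torusChar k.toTorusSite (-Pi.single 0 1)) +
      (torusChar k.toTorusSite (Pi.single 1 1) + torusChar k.toTorusSite (-Pi.single 1 1)) by ring,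
    torusChar_single_add_neg hL, torusChar_single_add_neg hL]
  push_cast
  ring

/-- `Π_{l<4} χ_k(s_l) = χ_k(s₀ + s₁ + s₂ + s₃)`. [cite: FriedliVelenik2017, §10.4] -/
theorem prod_torusChar_four (k : TorusSite 2 L) (s : Fin 4 → TorusSite 2 L) :
    ∏ l : Fin 4, torusChar k (s l) = torusChar k (∑ l : Fin 4, s l) := by
  rw [Fin.prod_univ_four, Fin.sum_univ_four, torusChar_add_right, torusChar_add_right, torusChar_add_right]

omit [NeZero L] in
/-- A four-step walk on `(ℤ/Lℤ)²`, `L ≥ 5`, closes iff it closes on `ℤ²`: with the integer coordinates of the steps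
`A = (1, −1, 0, 0)`, `B = (0, 0, 1, −1)`, `Σ_l s_{p(l)} = 0 ↔ Σ_l A(p l) = 0 ∧ Σ_l B(p l) = 0`.
[cite: FriedliVelenik2017, §10.4] -/
theorem step_sum_eq_zero_iff (hL : 5 ≤ L) (p : Fin 4 → Fin 4) :
    (∑ l : Fin 4, ((![Pi.single 0 1, -(Pi.single 0 1), Pi.single 1 1, -(Pi.single 1 1)] :
        Fin 4 → TorusSite 2 L) (p l))) = 0 ↔
      (∑ l : Fin 4, (![1, -1, 0, 0] : Fin 4 → ℤ) (p l) = 0 ∧ ∑ l : Fin 4, (![0, 0, 1, -1] : Fin 4 → ℤ) (p l) = 0) := by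
  -- coordinates of the steps
  have hcoord : ∀ j : Fin 4, ((![Pi.single 0 1, -(Pi.single 0 1), Pi.single 1 1, -(Pi.single 1 1)] :
        Fin 4 → TorusSite 2 L) j) = fun i : Fin 2 =>
          (((![![1, -1, 0, 0], ![0, 0, 1, -1]] : Fin 2 → Fin 4 → ℤ) i j : ℤ) : ZMod L) := by
    intro j
    funext i
    fin_cases j <;> fin_cases i <;> simp
  have hsmall : ∀ (c : Fin 4 → ℤ), (∀ j, c j = 1 ∨ c j = -1 ∨ c j = 0) →
      ((((∑ l : Fin 4, c (p l) : ℤ)) : ZMod L) = 0 ↔ ∑ l : Fin 4, c (p l) = 0) := by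
    intro c hc
    constructor
    · intro h
      rw [ZMod.intCast_zmod_eq_zero_iff_dvd] at h
      refine Int.eq_zero_of_dvd_of_natAbs_lt_natAbs h ?_
      have hb : (∑ l : Fin 4, c (p l)).natAbs ≤ 4 := by
        have h1 : ∀ l : Fin 4, (c (p l)).natAbs ≤ 1 := by
          intro l
          rcases hc (p l) with h | h | h <;> simp [h]
        calc (∑ l : Fin 4, c (p l)).natAbs ≤ ∑ l : Fin 4, (c (p l)).natAbs := Int.natAbs_sum_le _ _
          _ ≤ ∑ _l : Fin 4, 1 := Finset.sum_le_sum fun l _ => h1 l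
          _ = 4 := by simp
      have : (L : ℤ).natAbs = L := Int.natAbs_natCast L
      omega
    · intro h
      rw [h, Int.cast_zero]
  simp_rw [hcoord]
  rw [funext_iff]
  simp only [Finset.sum_apply, Pi.zero_apply, Fin.forall_fin_two]
  simp only [Matrix.cons_val_zero, Matrix.cons_val_one]
  rw [← Int.cast_sum, ← Int.cast_sum, hsmall _ (by intro j; fin_cases j <;> simp),
    hsmall _ (by intro j; fin_cases j <;> simp)]

/-- The number of closed four-step walks on `ℤ²` is `36`. [cite: FriedliVelenik2017, §10.4] -/
theorem card_closed_four_walks :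
    (Finset.univ.filter (fun p : Fin 4 → Fin 4 =>
      ∑ l : Fin 4, (![1, -1, 0, 0] : Fin 4 → ℤ) (p l) = 0 ∧ ∑ l : Fin 4, (![0, 0, 1, -1] : Fin 4 → ℤ) (p l) = 0)).card = 36 := by
  decide

/-- **The fourth band moment**: `Σ_k ε_t(k)⁴ = 36 t⁴ L²` on `(ℤ/Lℤ)²`, `L ≥ 5` (`ε_t(k) = 2t(cos p₁ + cos p₂)`; the `36`
closed four-step walks). [cite: FriedliVelenik2017, §10.4] -/
theorem sum_siteBand_pow_four (hL : 5 ≤ L) (t : ℝ) :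
    ∑ k : FermionTorus 2 L, siteBand t k ^ 4 = 36 * t ^ 4 * (L : ℝ) ^ 2 := by
  classical
  set s : Fin 4 → TorusSite 2 L := ![Pi.single 0 1, -(Pi.single 0 1), Pi.single 1 1, -(Pi.single 1 1)] with hs
  have hL2 : 2 ≤ L := by omega
  -- complexify
  have hC : ∀ k : FermionTorus 2 L, (((siteBand t k ^ 4 : ℝ)) : ℂ) =
      (t : ℂ) ^ 4 * ∑ p : Fin 4 → Fin 4, torusChar k.toTorusSite (∑ l, s (p l)) := by
    intro k
    push_cast
    rw [siteBand_eq_sum_torusChar hL2 t k, mul_pow]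
    congr 1
    rw [← hs]
    have h := (Finset.prod_univ_sum (fun (_ : Fin 4) => (Finset.univ : Finset (Fin 4)))
      (fun _ j => torusChar k.toTorusSite (s j)))
    rw [Finset.prod_const, Finset.card_univ, Fintype.card_fin, Fintype.piFinset_univ] at h
    rw [h]
    refine Finset.sum_congr rfl fun p _ => ?_
    exact prod_torusChar_four _ _
  have hsum : ∑ k : FermionTorus 2 L, (((siteBand t k ^ 4 : ℝ)) : ℂ) = ((36 * t ^ 4 * (L : ℝ) ^ 2 : ℝ) : ℂ) := by
    simp_rw [hC]
    rw [← Finset.mul_sum, FermionTorus.sum_eq_sum_torusSite]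
    simp only [FermionTorus.toTorusSite_ofTorusSite]
    rw [Finset.sum_comm]
    simp_rw [sum_torusChar_left]
    simp only [hs]
    simp_rw [step_sum_eq_zero_iff hL]
    rw [Finset.sum_ite, Finset.sum_const_zero, add_zero, Finset.sum_const, card_closed_four_walks, nsmul_eq_mul]
    push_cast
    ring
  exact_mod_cast hsum

omit [NeZero L] in
/-- `ε_t(k)² ≤ 16t²`. [cite: LangerMattis1971, eq. (3)] -/
theorem siteBand_sq_le (t : ℝ) (k : FermionTorus 2 L) : siteBand t k ^ 2 ≤ 16 * t ^ 2 := by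
  have h1 : |Real.cos (latticeMomentum L k.toTorusSite 0)| ≤ 1 := Real.abs_cos_le_one _
  have h2 : |Real.cos (latticeMomentum L k.toTorusSite 1)| ≤ 1 := Real.abs_cos_le_one _
  have hb : siteBand t k = t * (2 * (Real.cos (latticeMomentum L k.toTorusSite 0) +
      Real.cos (latticeMomentum L k.toTorusSite 1))) := by
    simp only [siteBand, Fin.sum_univ_two]
  have hc : (Real.cos (latticeMomentum L k.toTorusSite 0) + Real.cos (latticeMomentum L k.toTorusSite 1)) ^ 2 ≤ 4 := by
    rw [abs_le] at h1 h2
    nlinarith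
  rw [hb]
  nlinarith [sq_nonneg t]

end FourthMoment

end NeelClassFloor

end Summit.Ventures.CertifiedManyBodySolver.Observables

end
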